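import Summits.QuantumFields.YangMills.Theorems.FluctuationComparisonRegPrIntLSupTailReduction
import HarnessLib

/-!
# S2β IN CANONICAL CURRENCY: `FluctuationPartSmall` (registry v11.4 :412) ⟺ the SAME text read on ONE tree function `heightDensityCan F γ hJK univ`
# with two displayed rows — the `∀ ν (2 rows) ∀ ρ (3 rows)` schema of :412 carries no content beyond them

Cell `ym3-torus` (HUMAN RULING D-0037: rung R3 = continuum `SU(2)` Yang–Mills on `T³` — NOT `d = 4`, NOT infinite volume, NOT a mass gap, NOT the Clay
problem); width seat `ym-ust-20520-w5` (gen 19); helper of the crux `stmt-QuantumFields-20520` `UnitScaleTilt.FluctuationComparisonRegPrIntL`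
(`--supports … --as helper`, NOT a proof of it).  THEOREMS ONLY: 0 `def`, 0 `instance`, 0 `notation`, 0 `sorry`, default heartbeats.

CONTEXT.  The organ S2β `FluctuationPartSmall` (`Cruxes/FluctuationComparisonRegPrIntL/Lines/semiclassical_s2beta.lean` v11.4 3732b7df :412, the crux_decl of the
registered skeleton) reads, at every `J ≤ K`, «for every tower `ν` (`ν K K = Gibbs_K`, `ν K j = (descend j)_* ν K (j+1)`) and every version `ρ` of `ν K J` positive and
continuous on the window `W_J = {PlaqSmall θ_J}`, the 4-point of `log ρ + β_K·minActionRegPr` is `≤ φ J·e^{−κ d}`».  The tree already knows (px19 g11 VERS ✓p752318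
`…OddsLedgerVers.fullVersionConstCan` ∕ `tower_eq_map_descendTo`; LEAD w3 g17 ✓`…SupTailReduction.heightDensityCan_univ_eqOn`) that the tower IS `(D_{J,K})_* Gibbs_K`
and that ANY such `ρ` IS `Z_K⁻¹·heightDensityCan F γ hJK univ` on the window, pointwise.  THIS FILE turns that into a NORMAL FORM of S2β:

  S2β^{can} := S2β's text with the block «`∀ ν` + 2 `ν`-rows + `∀ (ρ : …)` + 3 `ρ`-rows» (2 function binders, 5 hypothesis rows) REPLACED by 2 rows on the ONE
  tree function `heightDensityCan F γ hJK Set.univ` (✓`…WregGlue.heightDensityCan`): (r1) `W_J ⊆ Node00.regSet dU (heightDensity F γ hJK Set.univ)`,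
  (r2) `∀ U ∈ W_J, 0 < heightDensityCan F γ hJK Set.univ U`; the 4-point read on `log heightDensityCan … univ + β_K·minActionRegPr`; all else BYTE-IDENTICAL.

* §1 the TOWER OF RECORD `ν K j := (descendTo j K)_* Gibbs_K` (`j ≤ K`; `0` else) satisfies S2β's two `ν`-rows (`tower_self`, `tower_step`);
* §2 `canonical_rows` — under (r1)(r2) the function `Z_K⁻¹·heightDensityCan … univ` satisfies S2β's three `ρ`-rows for that tower;
  `version_rows` — conversely an admissible `(ν, ρ)` yields (r1), (r2) and `log ρ = log heightDensityCan … univ − log Z_K` on the window;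
* §3 ★★★`fluctuationPartSmall_of_can : ⟨S2β^{can}⟩ → ⟨S2β :412 VERBATIM⟩` (same `pS ε₁ γ₁ κ φ`; `log Z_K` cancels in the 4-point) · ★★`can_of_fluctuationPartSmall :
  ⟨S2β⟩ → ⟨S2β^{can}⟩` · ★★★`fluctuationPartSmall_iff_can`.

WHAT IT BUYS (honest; CREDITS NOTHING): hands on S2β (the ideator's POLY∘∕POLYⁿ∘∕GRAD∘∕OSC¹∘∕CRUDELOC re-cuts, RECORD 17cd's `J < K` doors) may type against ONE function
per `(J, K)` with two displayed rows; S2β itself is untouched and NOT proved; nothing of 20520 ∕ EX ∕ 19936 ∕ 19200 is proved; `YM3TorusSU2` NOT proved; the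
Yang–Mills mass gap (Clay) NOT proved; rung R3 = YM₃ on `T³` — NOT `d = 4`, NOT infinite volume, NOT a mass gap.

References: [Balaban1985UV3] T. Bałaban, CMP 102 (1985): (2) p.256, (6)–(7) p.257 (the densities of the averaged Gibbs weight), (41) p.266; [Balaban1987RG1] CMP 109
(1987) (0.11) p.253, (0.13) p.254 (one averaging formula at every level; continuous versions).
-/

set_option autoImplicit false

noncomputable section

open MeasureTheory Filter Topology Set
open scoped ENNReal
open Literature.MathematicalPhysics.QuantumFieldTheory.Balaban1983to89
open Literature.MathematicalPhysics.QuantumFieldTheory.Balaban1983to89.T3ContinuumYM3Torus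
open Literature.MathematicalPhysics.QuantumFieldTheory.Balaban1983to89.T3NestedUnitLaws
open Literature.MathematicalPhysics.QuantumFieldTheory.Balaban1983to89.T3UnitLawDensityEML
open Literature.MathematicalPhysics.QuantumFieldTheory.Balaban1983to89.T3UnitScaleTilt
open Literature.MathematicalPhysics.QuantumFieldTheory.Balaban1983to89.T3TiltDescent
open Literature.MathematicalPhysics.QuantumFieldTheory.Balaban1983to89.T3PrintedRegularMinimiser
open Literature.MathematicalPhysics.QuantumFieldTheory.Balaban1983to89.T3LevelShift
open Literature.MathematicalPhysics.QuantumFieldTheory.Balaban1983to89.Missing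
open Literature.MathematicalPhysics.QuantumFieldTheory.Balaban1983to89.T4Continuum
open scoped Literature.MathematicalPhysics.QuantumFieldTheory.Balaban1983to89.T3OrbitAverage
open Summit.QuantumFields.YangMills.Theorems.FluctuationComparisonRegPrIntLWregGlue (heightDensityCan)
open Summit.QuantumFields.YangMills.Theorems.FluctuationComparisonRegPrIntLOddsLedgerVers (descend_eq_descendTo tower_eq_map_descendTo)
open Summit.QuantumFields.YangMills.Theorems.FluctuationComparisonRegPrIntLSupTailReduction (heightDensityCan_univ_eqOn)

namespace Summit.QuantumFields.YangMills.Theorems.FluctuationComparisonRegPrIntLS2BetaCanonicalCurrency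

/-! ## §1 The tower of record `ν K j := (descendTo j K)_* Gibbs_K` -/

section Tower

variable (F : T3Family) (γ : ℝ)

/-- The tower of record at `j = K` IS the Gibbs measure (`descendTo K K = id`). [cite: Balaban1987RG1, (0.11) p.253] -/
theorem tower_self (K : ℕ) :
    (fun (K j : ℕ) => if h : j ≤ K then Measure.map (descendTo F ℰp j K h) (gibbsK F ℰp γ K)
        else (0 : Measure (GaugeField (F.P j) 0 (Matrix.specialUnitaryGroup (Fin 2) ℂ)))) K K =
      T4GenFunBounds.gibbsMeasure (F.P K) ((F.scheme ℰp γ).β K) := by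
  simp only [dif_pos le_rfl]
  have hid : descendTo F ℰp K K le_rfl = id := funext fun U => T3DescentFibreTower.descendTo_self F ℰp K U
  rw [hid, Measure.map_id, gibbsK_eq]

/-- The tower of record satisfies the one-step nesting `ν K j = (descend j)_* ν K (j+1)` (`j < K`): `descend j ∘ descendTo (j+1) K = descendTo j K`.
[cite: Balaban1987RG1, (0.11) p.253] -/
theorem tower_step (K j : ℕ) (hj : j < K) :
    (fun (K j : ℕ) => if h : j ≤ K then Measure.map (descendTo F ℰp j K h) (gibbsK F ℰp γ K)
        else (0 : Measure (GaugeField (F.P j) 0 (Matrix.specialUnitaryGroup (Fin 2) ℂ)))) K j =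
      Measure.map (descend F ℰp j)
        ((fun (K j : ℕ) => if h : j ≤ K then Measure.map (descendTo F ℰp j K h) (gibbsK F ℰp γ K)
          else (0 : Measure (GaugeField (F.P j) 0 (Matrix.specialUnitaryGroup (Fin 2) ℂ)))) K (j + 1)) := by
  simp only [dif_pos hj.le, dif_pos (Nat.succ_le_of_lt hj)]
  rw [Measure.map_map (measurable_descend F ℰp measurableE_ℰp j) (measurable_descendTo F ℰp measurableE_ℰp _)]
  congr 1
  funext U
  simp only [Function.comp_apply, descend_eq_descendTo]
  exact (T3DescentFibreTower.descendTo_descendTo F ℰp _ _ U).symm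

end Tower

/-! ## §2 The canonical version as an admissible version, and conversely -/

section Versions

variable (F : T3Family) {γ : ℝ} (b₀ p₀ : ℝ) {J K : ℕ} (hJK : J ≤ K)

/-- **UNDER (r1)(r2) THE FUNCTION `Z_K⁻¹·heightDensityCan … univ` SATISFIES S2β's THREE `ρ`-ROWS FOR THE TOWER OF RECORD**: positive on the window, a density of
`(D_{J,K})_* Gibbs_K` (✓`map_descendTo_restrict_eq_withDensity` at `S = univ` + `canonVersion_ae_eq`), continuous on the window (canonical version continuous on `regSet ⊇ W_J`).
[cite: Balaban1985UV3, (2) p.256 and (6) p.257; Balaban1987RG1, (0.13) p.254] -/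
theorem canonical_rows (hγ : 0 < γ)
    (hR : {U : GaugeField (F.P J) 0 (Matrix.specialUnitaryGroup (Fin 2) ℂ) | PlaqSmall (θBal F.L γ b₀ p₀ J) U} ⊆
      Node00.regSet (fieldMeasure (F.P J) 0 (Matrix.specialUnitaryGroup (Fin 2) ℂ)) (heightDensity F γ hJK Set.univ))
    (hP : ∀ U : GaugeField (F.P J) 0 (Matrix.specialUnitaryGroup (Fin 2) ℂ), PlaqSmall (θBal F.L γ b₀ p₀ J) U →
      0 < heightDensityCan F γ hJK Set.univ U) :
    (∀ U, PlaqSmall (θBal F.L γ b₀ p₀ J) U →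
        0 < (partitionFn (G := Matrix.specialUnitaryGroup (Fin 2) ℂ) (F.P K) ((F.scheme ℰp γ).β K))⁻¹ * heightDensityCan F γ hJK Set.univ U) ∧
      Measure.map (descendTo F ℰp J K hJK) (gibbsK F ℰp γ K) =
        (fieldMeasure _ _ _).withDensity (fun U => ENNReal.ofReal
          ((partitionFn (G := Matrix.specialUnitaryGroup (Fin 2) ℂ) (F.P K) ((F.scheme ℰp γ).β K))⁻¹ * heightDensityCan F γ hJK Set.univ U)) ∧
      ContinuousOn (fun U => (partitionFn (G := Matrix.specialUnitaryGroup (Fin 2) ℂ) (F.P K) ((F.scheme ℰp γ).β K))⁻¹ * heightDensityCan F γ hJK Set.univ U)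
        {U | PlaqSmall (θBal F.L γ b₀ p₀ J) U} := by
  haveI := B12ContinuousTransportInvariance.isOpenPosMeasure_fieldMeasure_SU (N := 2) (F.P J) 0
  have hZ : 0 < partitionFn (G := Matrix.specialUnitaryGroup (Fin 2) ℂ) (F.P K) ((F.scheme ℰp γ).β K) :=
    partitionFn_pos' _ (F.scheme_β_nonneg ℰp hγ.le K)
  refine ⟨fun U hU => mul_pos (inv_pos.mpr hZ) (hP U hU), ?_, ?_⟩
  · rw [← Measure.restrict_univ (μ := gibbsK F ℰp γ K), map_descendTo_restrict_eq_withDensity F hJK MeasurableSet.univ hγ.le]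
    refine withDensity_congr_ae ?_
    have hae : heightDensityCan F γ hJK Set.univ =ᵐ[fieldMeasure (F.P J) 0 (Matrix.specialUnitaryGroup (Fin 2) ℂ)] heightDensity F γ hJK Set.univ :=
      Node00.canonVersion_ae_eq
    filter_upwards [hae] with U hU
    rw [hU]
  · exact continuousOn_const.mul (Node00.continuousOn_canonVersion.mono hR)

/-- **CONVERSELY, AN ADMISSIBLE `(ν, ρ)` YIELDS (r1), (r2) AND `log ρ = log heightDensityCan … univ − log Z_K` ON THE WINDOW** (the tower IS `(D_{J,K})_* Gibbs_K`,
✓`tower_eq_map_descendTo`; the canonical version IS `Z_K·ρ` there, ✓`heightDensityCan_univ_eqOn`; `Z_K·ρ` is then a continuous version on the open window).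
[cite: Balaban1985UV3, (2) p.256 and (6) p.257; Balaban1987RG1, (0.13) p.254] -/
theorem version_rows (hγ : 0 < γ)
    (ν : ℕ → (j : ℕ) → Measure (GaugeField (F.P j) 0 (Matrix.specialUnitaryGroup (Fin 2) ℂ)))
    (hνK : ∀ K, ν K K = T4GenFunBounds.gibbsMeasure (F.P K) ((F.scheme ℰp γ).β K))
    (hνd : ∀ K j, j < K → ν K j = Measure.map (descend F ℰp j) (ν K (j + 1)))
    (ρ : GaugeField (F.P J) 0 (Matrix.specialUnitaryGroup (Fin 2) ℂ) → ℝ)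
    (hρpos : ∀ U, PlaqSmall (θBal F.L γ b₀ p₀ J) U → 0 < ρ U)
    (hνρ : ν K J = (fieldMeasure _ _ _).withDensity (fun U => ENNReal.ofReal (ρ U)))
    (hρc : ContinuousOn ρ {U | PlaqSmall (θBal F.L γ b₀ p₀ J) U}) :
    {U : GaugeField (F.P J) 0 (Matrix.specialUnitaryGroup (Fin 2) ℂ) | PlaqSmall (θBal F.L γ b₀ p₀ J) U} ⊆
        Node00.regSet (fieldMeasure (F.P J) 0 (Matrix.specialUnitaryGroup (Fin 2) ℂ)) (heightDensity F γ hJK Set.univ) ∧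
      (∀ U : GaugeField (F.P J) 0 (Matrix.specialUnitaryGroup (Fin 2) ℂ), PlaqSmall (θBal F.L γ b₀ p₀ J) U →
        0 < heightDensityCan F γ hJK Set.univ U) ∧
      (∀ U : GaugeField (F.P J) 0 (Matrix.specialUnitaryGroup (Fin 2) ℂ), PlaqSmall (θBal F.L γ b₀ p₀ J) U →
        Real.log (ρ U) = Real.log (heightDensityCan F γ hJK Set.univ U)
          - Real.log (partitionFn (G := Matrix.specialUnitaryGroup (Fin 2) ℂ) (F.P K) ((F.scheme ℰp γ).β K))) := by
  haveI := B12ContinuousTransportInvariance.isOpenPosMeasure_fieldMeasure_SU (N := 2) (F.P J) 0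
  set Z := partitionFn (G := Matrix.specialUnitaryGroup (Fin 2) ℂ) (F.P K) ((F.scheme ℰp γ).β K) with hZdef
  have hZ : 0 < Z := partitionFn_pos' _ (F.scheme_β_nonneg ℰp hγ.le K)
  have hWo : IsOpen {U : GaugeField (F.P J) 0 (Matrix.specialUnitaryGroup (Fin 2) ℂ) | PlaqSmall (θBal F.L γ b₀ p₀ J) U} :=
    Node00.isOpen_plaqSmall _
  have hlaw : Measure.map (descendTo F ℰp J K hJK) (gibbsK F ℰp γ K) =
      (fieldMeasure (F.P J) 0 (Matrix.specialUnitaryGroup (Fin 2) ℂ)).withDensity (fun U => ENNReal.ofReal (ρ U)) :=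
    (tower_eq_map_descendTo F γ ν hνK hνd hJK).symm.trans hνρ
  have hEq : EqOn (heightDensityCan F γ hJK Set.univ) (fun U => Z * ρ U) {U | PlaqSmall (θBal F.L γ b₀ p₀ J) U} :=
    heightDensityCan_univ_eqOn F b₀ p₀ hJK hγ ρ hρpos hlaw hρc
  refine ⟨?_, fun U hU => ?_, fun U hU => ?_⟩
  · refine Node00.subset_regSet hWo ⟨fun U => Z * ρ U, continuousOn_const.mul hρc, ?_⟩
    have hae : heightDensityCan F γ hJK Set.univ =ᵐ[fieldMeasure (F.P J) 0 (Matrix.specialUnitaryGroup (Fin 2) ℂ)] heightDensity F γ hJK Set.univ :=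
      Node00.canonVersion_ae_eq
    filter_upwards [ae_restrict_mem hWo.measurableSet, ae_restrict_of_ae hae] with U hU hU'
    rw [← hU', hEq hU]
  · rw [hEq hU]
    exact mul_pos hZ (hρpos U hU)
  · rw [hEq hU]
    show Real.log (ρ U) = Real.log (Z * ρ U) - Real.log Z
    rw [Real.log_mul hZ.ne' (hρpos U hU).ne']
    ring

end Versions

/-! ## §3 The doors and the equivalence -/

section Doors

/-- ★★★ **S2β `FluctuationPartSmall` (registry v11.4 :412, VERBATIM) FROM ITS CANONICAL EDITION S2β^{can}** (same `pS ε₁ γ₁ κ φ`): given an admissible `(ν, ρ)`,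
`version_rows` supplies (r1)(r2) and `log ρ = log heightDensityCan … univ − log Z_K` at the four corners — the constant cancels in the 4-point.
[cite: Balaban1985UV3, Thm 2 p.263 and (41) p.266] -/
theorem fluctuationPartSmall_of_can
    (h : ∀ (L : ℕ), ∃ pS : ℝ, ∀ (b₀ p₀ : ℝ), 0 < b₀ → pS ≤ p₀ → 0 < p₀ → ∃ ε₁ : ℝ, 0 < ε₁ ∧ ∀ (ε₀ : ℝ), 0 < ε₀ → ε₀ ≤ ε₁ →
      ∃ γ₁ : ℝ, 0 < γ₁ ∧ ∃ κ : ℝ, 0 < κ ∧ ∀ (F : T3Family) (γ : ℝ), F.L = L → 0 < γ → γ ≤ γ₁ →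
        ∃ (φ : ℕ → ℝ), (∀ J, 0 ≤ φ J) ∧ Tendsto (fun J : ℕ => (J : ℝ) * φ J) atTop (𝓝 0) ∧
          ∀ (J K : ℕ) (hJK : J ≤ K),
            {U : GaugeField (F.P J) 0 (Matrix.specialUnitaryGroup (Fin 2) ℂ) | PlaqSmall (θBal F.L γ b₀ p₀ J) U} ⊆
              Node00.regSet (fieldMeasure (F.P J) 0 (Matrix.specialUnitaryGroup (Fin 2) ℂ)) (heightDensity F γ hJK Set.univ) →
            (∀ U : GaugeField (F.P J) 0 (Matrix.specialUnitaryGroup (Fin 2) ℂ), PlaqSmall (θBal F.L γ b₀ p₀ J) U → 0 < heightDensityCan F γ hJK Set.univ U) →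
              ∀ (b b' : PBond (F.P J) 0) (U V W Z : GaugeField (F.P J) 0 (Matrix.specialUnitaryGroup (Fin 2) ℂ)),
                PlaqSmall (θBal F.L γ b₀ p₀ J) U → PlaqSmall (θBal F.L γ b₀ p₀ J) V →
                PlaqSmall (θBal F.L γ b₀ p₀ J) W → PlaqSmall (θBal F.L γ b₀ p₀ J) Z →
                (∀ e, e ≠ b → U e = V e) → (∀ e, e ≠ b' → U e = W e) → (∀ e, e ≠ b' → V e = Z e) → (∀ e, e ≠ b → W e = Z e) →
                |((Real.log (heightDensityCan F γ hJK Set.univ U) + (F.scheme ℰp γ).β K * minActionRegPr F J K hJK ε₀ U)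
                    - (Real.log (heightDensityCan F γ hJK Set.univ V) + (F.scheme ℰp γ).β K * minActionRegPr F J K hJK ε₀ V))
                  - ((Real.log (heightDensityCan F γ hJK Set.univ W) + (F.scheme ℰp γ).β K * minActionRegPr F J K hJK ε₀ W)
                    - (Real.log (heightDensityCan F γ hJK Set.univ Z) + (F.scheme ℰp γ).β K * minActionRegPr F J K hJK ε₀ Z))|
                  ≤ φ J * Real.exp (-(κ * (b.src.tdist b'.src : ℝ)))) :
    ∀ (L : ℕ), ∃ pS : ℝ, ∀ (b₀ p₀ : ℝ), 0 < b₀ → pS ≤ p₀ → 0 < p₀ → ∃ ε₁ : ℝ, 0 < ε₁ ∧ ∀ (ε₀ : ℝ), 0 < ε₀ → ε₀ ≤ ε₁ →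
      ∃ γ₁ : ℝ, 0 < γ₁ ∧ ∃ κ : ℝ, 0 < κ ∧ ∀ (F : T3Family) (γ : ℝ), F.L = L → 0 < γ → γ ≤ γ₁ →
        ∃ (φ : ℕ → ℝ), (∀ J, 0 ≤ φ J) ∧ Tendsto (fun J : ℕ => (J : ℝ) * φ J) atTop (𝓝 0) ∧
          ∀ (ν : ℕ → (j : ℕ) → Measure (GaugeField (F.P j) 0 (Matrix.specialUnitaryGroup (Fin 2) ℂ))),
            (∀ K, ν K K = T4GenFunBounds.gibbsMeasure (F.P K) ((F.scheme ℰp γ).β K)) →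
            (∀ K j, j < K → ν K j = Measure.map (descend F ℰp j) (ν K (j + 1))) →
            ∀ (J K : ℕ) (hJK : J ≤ K) (ρ : GaugeField (F.P J) 0 (Matrix.specialUnitaryGroup (Fin 2) ℂ) → ℝ),
              (∀ U, PlaqSmall (θBal F.L γ b₀ p₀ J) U → 0 < ρ U) →
              ν K J = (fieldMeasure _ _ _).withDensity (fun U => ENNReal.ofReal (ρ U)) →
              ContinuousOn ρ {U | PlaqSmall (θBal F.L γ b₀ p₀ J) U} →
              ∀ (b b' : PBond (F.P J) 0) (U V W Z : GaugeField (F.P J) 0 (Matrix.specialUnitaryGroup (Fin 2) ℂ)),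
                PlaqSmall (θBal F.L γ b₀ p₀ J) U → PlaqSmall (θBal F.L γ b₀ p₀ J) V →
                PlaqSmall (θBal F.L γ b₀ p₀ J) W → PlaqSmall (θBal F.L γ b₀ p₀ J) Z →
                (∀ e, e ≠ b → U e = V e) → (∀ e, e ≠ b' → U e = W e) → (∀ e, e ≠ b' → V e = Z e) → (∀ e, e ≠ b → W e = Z e) →
                |((Real.log (ρ U) + (F.scheme ℰp γ).β K * minActionRegPr F J K hJK ε₀ U)
                    - (Real.log (ρ V) + (F.scheme ℰp γ).β K * minActionRegPr F J K hJK ε₀ V))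
                  - ((Real.log (ρ W) + (F.scheme ℰp γ).β K * minActionRegPr F J K hJK ε₀ W)
                    - (Real.log (ρ Z) + (F.scheme ℰp γ).β K * minActionRegPr F J K hJK ε₀ Z))|
                  ≤ φ J * Real.exp (-(κ * (b.src.tdist b'.src : ℝ))) := by
  intro L
  obtain ⟨pS, H⟩ := h L
  refine ⟨pS, fun b₀ p₀ hb hpS hp => ?_⟩
  obtain ⟨ε₁, hε₁, H⟩ := H b₀ p₀ hb hpS hp
  refine ⟨ε₁, hε₁, fun ε₀ hε₀ hε₀1 => ?_⟩
  obtain ⟨γ₁, hγ₁, κ, hκ, H⟩ := H ε₀ hε₀ hε₀1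
  refine ⟨γ₁, hγ₁, κ, hκ, fun F γ hFL hγ hγle => ?_⟩
  obtain ⟨φ, hφ0, hφt, H⟩ := H F γ hFL hγ hγle
  refine ⟨φ, hφ0, hφt, fun ν hνK hνd J K hJK ρ hρpos hνρ hρc b b' U V W Z hU hV hW hZ hUV hUW hVZ hWZ => ?_⟩
  obtain ⟨hR, hP, hlog⟩ := version_rows F b₀ p₀ hJK hγ ν hνK hνd ρ hρpos hνρ hρc
  have key := H J K hJK hR hP b b' U V W Z hU hV hW hZ hUV hUW hVZ hWZ
  rw [hlog U hU, hlog V hV, hlog W hW, hlog Z hZ]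
  convert key using 2
  ring

/-- ★★ **THE CANONICAL EDITION FROM S2β**: feed :412 the tower of record (§1) and the version `Z_K⁻¹·heightDensityCan … univ` (`canonical_rows`); `log Z_K⁻¹` cancels.
[cite: Balaban1985UV3, Thm 2 p.263 and (41) p.266] -/
theorem can_of_fluctuationPartSmall
    (h : ∀ (L : ℕ), ∃ pS : ℝ, ∀ (b₀ p₀ : ℝ), 0 < b₀ → pS ≤ p₀ → 0 < p₀ → ∃ ε₁ : ℝ, 0 < ε₁ ∧ ∀ (ε₀ : ℝ), 0 < ε₀ → ε₀ ≤ ε₁ →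
      ∃ γ₁ : ℝ, 0 < γ₁ ∧ ∃ κ : ℝ, 0 < κ ∧ ∀ (F : T3Family) (γ : ℝ), F.L = L → 0 < γ → γ ≤ γ₁ →
        ∃ (φ : ℕ → ℝ), (∀ J, 0 ≤ φ J) ∧ Tendsto (fun J : ℕ => (J : ℝ) * φ J) atTop (𝓝 0) ∧
          ∀ (ν : ℕ → (j : ℕ) → Measure (GaugeField (F.P j) 0 (Matrix.specialUnitaryGroup (Fin 2) ℂ))),
            (∀ K, ν K K = T4GenFunBounds.gibbsMeasure (F.P K) ((F.scheme ℰp γ).β K)) →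
            (∀ K j, j < K → ν K j = Measure.map (descend F ℰp j) (ν K (j + 1))) →
            ∀ (J K : ℕ) (hJK : J ≤ K) (ρ : GaugeField (F.P J) 0 (Matrix.specialUnitaryGroup (Fin 2) ℂ) → ℝ),
              (∀ U, PlaqSmall (θBal F.L γ b₀ p₀ J) U → 0 < ρ U) →
              ν K J = (fieldMeasure _ _ _).withDensity (fun U => ENNReal.ofReal (ρ U)) →
              ContinuousOn ρ {U | PlaqSmall (θBal F.L γ b₀ p₀ J) U} →
              ∀ (b b' : PBond (F.P J) 0) (U V W Z : GaugeField (F.P J) 0 (Matrix.specialUnitaryGroup (Fin 2) ℂ)),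
                PlaqSmall (θBal F.L γ b₀ p₀ J) U → PlaqSmall (θBal F.L γ b₀ p₀ J) V →
                PlaqSmall (θBal F.L γ b₀ p₀ J) W → PlaqSmall (θBal F.L γ b₀ p₀ J) Z →
                (∀ e, e ≠ b → U e = V e) → (∀ e, e ≠ b' → U e = W e) → (∀ e, e ≠ b' → V e = Z e) → (∀ e, e ≠ b → W e = Z e) →
                |((Real.log (ρ U) + (F.scheme ℰp γ).β K * minActionRegPr F J K hJK ε₀ U)
                    - (Real.log (ρ V) + (F.scheme ℰp γ).β K * minActionRegPr F J K hJK ε₀ V))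
                  - ((Real.log (ρ W) + (F.scheme ℰp γ).β K * minActionRegPr F J K hJK ε₀ W)
                    - (Real.log (ρ Z) + (F.scheme ℰp γ).β K * minActionRegPr F J K hJK ε₀ Z))|
                  ≤ φ J * Real.exp (-(κ * (b.src.tdist b'.src : ℝ)))) :
    ∀ (L : ℕ), ∃ pS : ℝ, ∀ (b₀ p₀ : ℝ), 0 < b₀ → pS ≤ p₀ → 0 < p₀ → ∃ ε₁ : ℝ, 0 < ε₁ ∧ ∀ (ε₀ : ℝ), 0 < ε₀ → ε₀ ≤ ε₁ →
      ∃ γ₁ : ℝ, 0 < γ₁ ∧ ∃ κ : ℝ, 0 < κ ∧ ∀ (F : T3Family) (γ : ℝ), F.L = L → 0 < γ → γ ≤ γ₁ →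
        ∃ (φ : ℕ → ℝ), (∀ J, 0 ≤ φ J) ∧ Tendsto (fun J : ℕ => (J : ℝ) * φ J) atTop (𝓝 0) ∧
          ∀ (J K : ℕ) (hJK : J ≤ K),
            {U : GaugeField (F.P J) 0 (Matrix.specialUnitaryGroup (Fin 2) ℂ) | PlaqSmall (θBal F.L γ b₀ p₀ J) U} ⊆
              Node00.regSet (fieldMeasure (F.P J) 0 (Matrix.specialUnitaryGroup (Fin 2) ℂ)) (heightDensity F γ hJK Set.univ) →
            (∀ U : GaugeField (F.P J) 0 (Matrix.specialUnitaryGroup (Fin 2) ℂ), PlaqSmall (θBal F.L γ b₀ p₀ J) U → 0 < heightDensityCan F γ hJK Set.univ U) →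
              ∀ (b b' : PBond (F.P J) 0) (U V W Z : GaugeField (F.P J) 0 (Matrix.specialUnitaryGroup (Fin 2) ℂ)),
                PlaqSmall (θBal F.L γ b₀ p₀ J) U → PlaqSmall (θBal F.L γ b₀ p₀ J) V →
                PlaqSmall (θBal F.L γ b₀ p₀ J) W → PlaqSmall (θBal F.L γ b₀ p₀ J) Z →
                (∀ e, e ≠ b → U e = V e) → (∀ e, e ≠ b' → U e = W e) → (∀ e, e ≠ b' → V e = Z e) → (∀ e, e ≠ b → W e = Z e) →
                |((Real.log (heightDensityCan F γ hJK Set.univ U) + (F.scheme ℰp γ).β K * minActionRegPr F J K hJK ε₀ U)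
                    - (Real.log (heightDensityCan F γ hJK Set.univ V) + (F.scheme ℰp γ).β K * minActionRegPr F J K hJK ε₀ V))
                  - ((Real.log (heightDensityCan F γ hJK Set.univ W) + (F.scheme ℰp γ).β K * minActionRegPr F J K hJK ε₀ W)
                    - (Real.log (heightDensityCan F γ hJK Set.univ Z) + (F.scheme ℰp γ).β K * minActionRegPr F J K hJK ε₀ Z))|
                  ≤ φ J * Real.exp (-(κ * (b.src.tdist b'.src : ℝ))) := by
  intro L
  obtain ⟨pS, H⟩ := h L
  refine ⟨pS, fun b₀ p₀ hb hpS hp => ?_⟩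
  obtain ⟨ε₁, hε₁, H⟩ := H b₀ p₀ hb hpS hp
  refine ⟨ε₁, hε₁, fun ε₀ hε₀ hε₀1 => ?_⟩
  obtain ⟨γ₁, hγ₁, κ, hκ, H⟩ := H ε₀ hε₀ hε₀1
  refine ⟨γ₁, hγ₁, κ, hκ, fun F γ hFL hγ hγle => ?_⟩
  obtain ⟨φ, hφ0, hφt, H⟩ := H F γ hFL hγ hγle
  refine ⟨φ, hφ0, hφt, fun J K hJK hR hP b b' U V W Z hU hV hW hZ hUV hUW hVZ hWZ => ?_⟩
  obtain ⟨hpos, hlaw, hcont⟩ := canonical_rows F b₀ p₀ hJK hγ hR hP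
  set Zi : ℝ := (partitionFn (G := Matrix.specialUnitaryGroup (Fin 2) ℂ) (F.P K) ((F.scheme ℰp γ).β K))⁻¹ with hZi
  have hZpos : 0 < partitionFn (G := Matrix.specialUnitaryGroup (Fin 2) ℂ) (F.P K) ((F.scheme ℰp γ).β K) :=
    partitionFn_pos' _ (F.scheme_β_nonneg ℰp hγ.le K)
  have key := H (fun (K j : ℕ) => if h : j ≤ K then Measure.map (descendTo F ℰp j K h) (gibbsK F ℰp γ K)
      else (0 : Measure (GaugeField (F.P j) 0 (Matrix.specialUnitaryGroup (Fin 2) ℂ))))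
    (tower_self F γ) (tower_step F γ) J K hJK (fun U => Zi * heightDensityCan F γ hJK Set.univ U) hpos
    (by simp only [dif_pos hJK]; exact hlaw) hcont b b' U V W Z hU hV hW hZ hUV hUW hVZ hWZ
  have hlog : ∀ X : GaugeField (F.P J) 0 (Matrix.specialUnitaryGroup (Fin 2) ℂ), PlaqSmall (θBal F.L γ b₀ p₀ J) X →
      Real.log (Zi * heightDensityCan F γ hJK Set.univ X) = Real.log Zi + Real.log (heightDensityCan F γ hJK Set.univ X) :=
    fun X hX => Real.log_mul (inv_ne_zero hZpos.ne') (hP X hX).ne'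
  simp only [hlog U hU, hlog V hV, hlog W hW, hlog Z hZ] at key
  convert key using 2
  ring

/-- ★★★ **S2β ⟺ S2β^{can}** — the `∀ ν ∀ ρ` schema of :412 is equivalent to two displayed rows on ONE tree function. [cite: Balaban1985UV3, (41) p.266] -/
theorem fluctuationPartSmall_iff_can :
    (∀ (L : ℕ), ∃ pS : ℝ, ∀ (b₀ p₀ : ℝ), 0 < b₀ → pS ≤ p₀ → 0 < p₀ → ∃ ε₁ : ℝ, 0 < ε₁ ∧ ∀ (ε₀ : ℝ), 0 < ε₀ → ε₀ ≤ ε₁ →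
      ∃ γ₁ : ℝ, 0 < γ₁ ∧ ∃ κ : ℝ, 0 < κ ∧ ∀ (F : T3Family) (γ : ℝ), F.L = L → 0 < γ → γ ≤ γ₁ →
        ∃ (φ : ℕ → ℝ), (∀ J, 0 ≤ φ J) ∧ Tendsto (fun J : ℕ => (J : ℝ) * φ J) atTop (𝓝 0) ∧
          ∀ (ν : ℕ → (j : ℕ) → Measure (GaugeField (F.P j) 0 (Matrix.specialUnitaryGroup (Fin 2) ℂ))),
            (∀ K, ν K K = T4GenFunBounds.gibbsMeasure (F.P K) ((F.scheme ℰp γ).β K)) →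
            (∀ K j, j < K → ν K j = Measure.map (descend F ℰp j) (ν K (j + 1))) →
            ∀ (J K : ℕ) (hJK : J ≤ K) (ρ : GaugeField (F.P J) 0 (Matrix.specialUnitaryGroup (Fin 2) ℂ) → ℝ),
              (∀ U, PlaqSmall (θBal F.L γ b₀ p₀ J) U → 0 < ρ U) →
              ν K J = (fieldMeasure _ _ _).withDensity (fun U => ENNReal.ofReal (ρ U)) →
              ContinuousOn ρ {U | PlaqSmall (θBal F.L γ b₀ p₀ J) U} →
              ∀ (b b' : PBond (F.P J) 0) (U V W Z : GaugeField (F.P J) 0 (Matrix.specialUnitaryGroup (Fin 2) ℂ)),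
                PlaqSmall (θBal F.L γ b₀ p₀ J) U → PlaqSmall (θBal F.L γ b₀ p₀ J) V →
                PlaqSmall (θBal F.L γ b₀ p₀ J) W → PlaqSmall (θBal F.L γ b₀ p₀ J) Z →
                (∀ e, e ≠ b → U e = V e) → (∀ e, e ≠ b' → U e = W e) → (∀ e, e ≠ b' → V e = Z e) → (∀ e, e ≠ b → W e = Z e) →
                |((Real.log (ρ U) + (F.scheme ℰp γ).β K * minActionRegPr F J K hJK ε₀ U)
                    - (Real.log (ρ V) + (F.scheme ℰp γ).β K * minActionRegPr F J K hJK ε₀ V))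
                  - ((Real.log (ρ W) + (F.scheme ℰp γ).β K * minActionRegPr F J K hJK ε₀ W)
                    - (Real.log (ρ Z) + (F.scheme ℰp γ).β K * minActionRegPr F J K hJK ε₀ Z))|
                  ≤ φ J * Real.exp (-(κ * (b.src.tdist b'.src : ℝ)))) ↔
    (∀ (L : ℕ), ∃ pS : ℝ, ∀ (b₀ p₀ : ℝ), 0 < b₀ → pS ≤ p₀ → 0 < p₀ → ∃ ε₁ : ℝ, 0 < ε₁ ∧ ∀ (ε₀ : ℝ), 0 < ε₀ → ε₀ ≤ ε₁ →
      ∃ γ₁ : ℝ, 0 < γ₁ ∧ ∃ κ : ℝ, 0 < κ ∧ ∀ (F : T3Family) (γ : ℝ), F.L = L → 0 < γ → γ ≤ γ₁ →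
        ∃ (φ : ℕ → ℝ), (∀ J, 0 ≤ φ J) ∧ Tendsto (fun J : ℕ => (J : ℝ) * φ J) atTop (𝓝 0) ∧
          ∀ (J K : ℕ) (hJK : J ≤ K),
            {U : GaugeField (F.P J) 0 (Matrix.specialUnitaryGroup (Fin 2) ℂ) | PlaqSmall (θBal F.L γ b₀ p₀ J) U} ⊆
              Node00.regSet (fieldMeasure (F.P J) 0 (Matrix.specialUnitaryGroup (Fin 2) ℂ)) (heightDensity F γ hJK Set.univ) →
            (∀ U : GaugeField (F.P J) 0 (Matrix.specialUnitaryGroup (Fin 2) ℂ), PlaqSmall (θBal F.L γ b₀ p₀ J) U → 0 < heightDensityCan F γ hJK Set.univ U) →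
              ∀ (b b' : PBond (F.P J) 0) (U V W Z : GaugeField (F.P J) 0 (Matrix.specialUnitaryGroup (Fin 2) ℂ)),
                PlaqSmall (θBal F.L γ b₀ p₀ J) U → PlaqSmall (θBal F.L γ b₀ p₀ J) V →
                PlaqSmall (θBal F.L γ b₀ p₀ J) W → PlaqSmall (θBal F.L γ b₀ p₀ J) Z →
                (∀ e, e ≠ b → U e = V e) → (∀ e, e ≠ b' → U e = W e) → (∀ e, e ≠ b' → V e = Z e) → (∀ e, e ≠ b → W e = Z e) →
                |((Real.log (heightDensityCan F γ hJK Set.univ U) + (F.scheme ℰp γ).β K * minActionRegPr F J K hJK ε₀ U)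
                    - (Real.log (heightDensityCan F γ hJK Set.univ V) + (F.scheme ℰp γ).β K * minActionRegPr F J K hJK ε₀ V))
                  - ((Real.log (heightDensityCan F γ hJK Set.univ W) + (F.scheme ℰp γ).β K * minActionRegPr F J K hJK ε₀ W)
                    - (Real.log (heightDensityCan F γ hJK Set.univ Z) + (F.scheme ℰp γ).β K * minActionRegPr F J K hJK ε₀ Z))|
                  ≤ φ J * Real.exp (-(κ * (b.src.tdist b'.src : ℝ)))) :=
  ⟨can_of_fluctuationPartSmall, fluctuationPartSmall_of_can⟩

end Doors

end Summit.QuantumFields.YangMills.Theorems.FluctuationComparisonRegPrIntLS2BetaCanonicalCurrency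

end
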